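import Summits.ABC.ABC.Theorems.TwistAmplificationMazurKaneLawRecordDEDictionary
import Summits.ABC.ABC.Theorems.TwistAmplificationMazurKaneLawRecordDEEndgame
import Summits.ABC.ABC.Theorems.TwistAmplificationMazurKaneLawRecordLPDEAdapter
import Summits.ABC.ABC.Theorems.TwistAmplificationMazurKaneLawRecordLPDE
import Summits.ABC.ABC.Theorems.TwistAmplificationMazurKaneLawRecordTransfer
import Summits.ABC.ABC.Theorems.TwistAmplificationMazurKaneLawRecords
import Summits.ABC.ABC.Theorems.TwistAmplificationMazurKaneLawRecordsV3
import Summits.ABC.ABC.Theorems.TwistAmplificationMazurKaneLawRecordsV4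

/-!
# Certified record exponents, pipeline v3 (the DE tool) — record `DE` on the plateau `[16/9, 2]` and the global corollary
# (crux `TwistAmplification.MazurKaneLaw`, stmt-ABC-2757)

Line `critical-kloosterman-powerful-moduli`, lead c4. The enlarged fibre toolkit (trivial, subset geometry of numbers, Fourier,
determinant, square-root lattice) has exact LP value `1` on the whole plateau `s ∈ [16/9, 2]` (`kit_lp_value_one_at_sixteen_ninths`,
record `recordAt_RW : RecordAt s₀ 1`): the binding families `R(δ,1)`, `R(δ,2)` of the wall map sit exactly at Kane's exponent. The new
DISPERSION/ENERGY tool of this line — a ratio Cauchy–Schwarz modulo the power modulus `q = W_Q(x)` carried by a host term, followed by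
a count of the multiplicative energy `#{A²C ≡ B²D (mod q)}` through root lattices, a super-Minkowski box count in the product
variables and a dyadic short-vector count (`…DE*.lean`, dictionary entry `dispersion_linear`) — is the first tool of the kit that is
not blind to the wall: with it the exact LP value on the plateau drops to `(2 + s)/4` (parametric certificate `lp_DE`, `J = 4`, slack
coefficient `K = 3`, 1041-node cover tree, every leaf re-verified by `linarith`), i.e.

* `recordAt_DE` : for every `s₀ ∈ [16/9, 2]`, `RecordAt s₀ ((2 + s₀)/4)` — exponent `17/18 = 0.9444…` at the wall `s₀ = 16/9`,
  `< 1` for every `s₀ < 2`, against the previous `1` (`recordAt_RW`, Kane's `N^{1+ε}`).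

In the crux's literal shape (`mazurKane_count_le_rpow_DE`): for `16/9 ≤ s < 2` and `ε > 0`,
`#{abc triples (a,b,c) : c ≤ N, rad(abc) ≤ c^s} ≤ C · N^{(2+s)/4 + ε}`. Together with the records below the wall (`recordAt_RA` on
`[1, 5/3]`, `recordAt_74`, `recordAt_RF` on `[7/4, 16/9]`) this gives the GLOBAL COROLLARY `mazurKane_exponent_lt_one`: for every
`s ∈ (1, 2)` the Mazur–Kane count at `s` is `O(N^{θ(s)+ε})` with an explicit `θ(s) < 1` — Kane's exponent `1` is now beaten at every
`s < 2` (the law asks for `θ(s) = s − 1`). Nothing here is conditional.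
-/

noncomputable section

-- `Summit.<Summit>.<Problem>`: the duplicate `ABC.ABC` is deliberate (single-conjunct summit).
set_option linter.dupNamespace false

namespace Summit.ABC.ABC.Theorems.MazurKaneLaw

open Summit.ABC.ABC.Theorems.MazurKaneLaw.Toolkit

/-! ### `DE`: `s₀ ∈ [16/9, 2]`, exponent `(2 + s₀)/4` -/

/-- **Parametric DE record instance**: for every `s₀ ∈ [16/9, 2]`, `RecordInstanceDE 3 4 s₀ ((2 + s₀)/4)`, from the generated
parametric LP lemma `lp_DE` (bundle form) through the adapter `lpCertDE_of_lpHypsDE4` and the DE dictionary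
`recordInstanceDE_of_lpCertDE`. [folklore] -/
theorem recordInstanceDE_plateau : ∀ s₀ : ℝ, 16 / 9 ≤ s₀ → s₀ ≤ 2 →
    Summit.ABC.ABC.Theorems.MazurKaneLaw.Toolkit.RecordInstanceDE 3 4 s₀ ((2 + s₀) / 4) :=
  fun s₀ h1 h2 => recordInstanceDE_of_lpCertDE 3 4 s₀ ((2 + s₀) / 4) (by norm_num) (lpCertDE_of_lpHypsDE4 lp_DE s₀ h1 h2)

/-- **Parametric certified record `DE`** (registered sub-goal `recordAt_DE` of crux stmt-ABC-2757): for every `s₀ ∈ [16/9, 2]`,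
every `s < s₀` and `ε > 0`, `#{abc triples, c ≤ N, rad(abc) ≤ c^s} ≤ C · N^{(2+s₀)/4 + ε}` for `N ≥ 2`. [folklore] -/
theorem recordAt_DE : ∀ s₀ : ℝ, 16 / 9 ≤ s₀ → s₀ ≤ 2 → Summit.ABC.ABC.Theorems.MazurKaneLaw.Toolkit.RecordAt s₀ ((2 + s₀) / 4) :=
  fun s₀ h1 h2 => recordAt_of_shapeBound 4 s₀ ((2 + s₀) / 4) (by norm_num) (by norm_num) (by linarith) (by linarith)
    (shapeCount_le_of_recordInstanceDE 3 4 s₀ ((2 + s₀) / 4) (by norm_num) (by norm_num) (by linarith)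
      (recordInstanceDE_plateau s₀ h1 h2))

/-- **`DE` in the crux's literal shape**: for `16/9 ≤ s < 2` and `ε > 0` there is `C` with
`#{abc triples (a,b,c) : c ≤ N, rad(abc) ≤ c^s} ≤ C · N^{(2+s)/4 + ε}` for all `N ≥ 2`. Take `s₀ = min 2 (s + ε)` in `recordAt_DE`
with `ε′ = ε/3`. [folklore] -/
theorem mazurKane_count_le_rpow_DE (s : ℝ) (hs1 : 16 / 9 ≤ s) (hs2 : s < 2) (ε : ℝ) (hε : 0 < ε) :
    ∃ C : ℝ, ∀ N : ℕ, 2 ≤ N →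
      (Set.ncard {t : ℕ × ℕ × ℕ | Literature.NumberTheory.DiophantineGeometry.IsABCTriple t.1 t.2.1 t.2.2 ∧ t.2.2 ≤ N ∧ ((Literature.NumberTheory.DiophantineGeometry.rad t.1 t.2.1 t.2.2 : ℕ) : ℝ) ≤ (t.2.2 : ℝ) ^ s} : ℝ) ≤
        C * (N : ℝ) ^ ((2 + s) / 4 + ε) := by
  -- adapted from `mazurKane_count_le_rpow_RG` (TwistAmplificationMazurKaneLawRecordsV5.lean)
  have hm1 : min 2 (s + ε) ≤ 2 := min_le_left _ _
  have hm2 : min 2 (s + ε) ≤ s + ε := min_le_right _ _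
  have hm3 : s < min 2 (s + ε) := lt_min hs2 (by linarith)
  obtain ⟨C, hC⟩ := recordAt_DE (min 2 (s + ε)) (by linarith) hm1 s hm3 (ε / 3) (by positivity)
  exact ⟨max C 0, fun N hN => record_bound_mono hN (by linarith) (hC N hN)⟩

/-! ### The global corollary: an exponent `< 1` at every `s < 2` -/

/-- **Kane's exponent is beaten at every `s ∈ (1, 2)`** (registered sub-goal `mazurKane_exponent_lt_one` of crux stmt-ABC-2757):
for every `1 < s < 2` there is `θ < 1` such that for every `ε > 0`, `#{abc triples (a,b,c) : c ≤ N, rad(abc) ≤ c^s} ≤ C · N^{θ+ε}`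
for all `N ≥ 2`. Cases: `s < 5/3` — `recordAt_RA` at `s₀ = 5/3` (`θ = 59/60`); `5/3 ≤ s < 7/4` — `recordAt_74` (`θ = 49/50`);
`7/4 ≤ s < 16/9` — `recordAt_RF` at `s₀ = (s + 16/9)/2` (`θ = 4s₀/5 − 19/45 < 1`); `16/9 ≤ s < 2` — `recordAt_DE` at
`s₀ = (s + 2)/2` (`θ = (2 + s₀)/4 < 1`). [folklore] -/
theorem mazurKane_exponent_lt_one : ∀ s : ℝ, 1 < s → s < 2 → ∃ θ : ℝ, θ < 1 ∧ ∀ ε : ℝ, 0 < ε → ∃ C : ℝ, ∀ N : ℕ, 2 ≤ N → (Set.ncard {t : ℕ × ℕ × ℕ | Literature.NumberTheory.DiophantineGeometry.IsABCTriple t.1 t.2.1 t.2.2 ∧ t.2.2 ≤ N ∧ ((Literature.NumberTheory.DiophantineGeometry.rad t.1 t.2.1 t.2.2 : ℕ) : ℝ) ≤ (t.2.2 : ℝ) ^ s} : ℝ) ≤ C * (N : ℝ) ^ (θ + ε) := by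
  intro s hs1 hs2
  rcases lt_or_ge s (5 / 3) with h53 | h53
  · refine ⟨(23 / 40 : ℝ) * (5 / 3) + (1 / 40 : ℝ), by norm_num, fun ε hε => ?_⟩
    exact recordAt_RA (5 / 3) (by norm_num) le_rfl s h53 ε hε
  rcases lt_or_ge s (7 / 4) with h74 | h74
  · exact ⟨49 / 50, by norm_num, fun ε hε => recordAt_74 s h74 ε hε⟩
  rcases lt_or_ge s (16 / 9) with h169 | h169
  · refine ⟨(4 / 5 : ℝ) * ((s + 16 / 9) / 2) - (19 / 45 : ℝ), by linarith, fun ε hε => ?_⟩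
    exact recordAt_RF ((s + 16 / 9) / 2) (by linarith) (by linarith) s (by linarith) ε hε
  · refine ⟨(2 + (s + 2) / 2) / 4, by linarith, fun ε hε => ?_⟩
    exact recordAt_DE ((s + 2) / 2) (by linarith) (by linarith) s (by linarith) ε hε

end Summit.ABC.ABC.Theorems.MazurKaneLaw

end
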